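import Literature.Geometry.Riemannian.RicciFlowMaximalScaling
import Literature.Geometry.Riemannian.KappaNoncollapsingScaling
import Literature.Geometry.Riemannian.PerelmanEntropy
import Literature.Geometry.Riemannian.MetricTraceScaling
import Literature.Geometry.Riemannian.WeylEnergyScaling
import HarnessLib

/-!
# The rescaled blow-up sequence of a maximal Ricci flow on a closed `4`-manifold

Stub `stub_rescaledSequence` of line `ancient-sphere-rigidity` for the crux
`EntropyRung.SubcylindricalRecognition` (stmt-SmoothPoincare4-10869): the parabolic rescaling
step of the blow-up at the first singular time (Hamilton 1995, §16; Topping 2006, (1.2.7) and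
§7.3), together with the scale invariance of Perelman's `μ` (Perelman 2002, §3.1; Topping 2006,
Prop. 8.1.2), which carries the entropy floor over to the rescaled flows.

## What

Given a maximal Ricci flow `(g, cov)` of Riemannian metrics on `M × [0, T)`, `κ`-noncollapsed
below `√T`, with `μ(g(t), τ) ≥ ν_cyl + δ'` (`t ∈ [0, T)`, `τ > 0`), and point-picking data
`t_k ∈ [0, T)`, `Q_k > 0`, `Q_k t_k ≥ k`, `|Rm| ≤ Q_k` on `M × [0, t_k]`, `|Rm|(x_k, t_k) ≥ Q_k / 2`
on a `g(t_k)`-unit-bounded quadruple (the output of `stub_pointPicking`), the flows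
`g_k(s) = Q_k g(t_k + s / Q_k)` on `[-Q_k t_k, 0]`, with the same connections, are Ricci flows of
Riemannian metrics with `|Rm| ≤ 1`, `|Rm_{g_k}|(x_k, 0) ≥ 1/2`, `κ`-noncollapsed below `√(Q_k t_k)`
(same `κ`) and with the floor `μ ≥ ν_cyl + δ'` (same `δ'`).

## Proof (fact-free; every ingredient is proved in `Literature/Geometry/Riemannian`)

* flow: `IsRicciFlow.parabolicRescale`, `.comp_add_const`, `.mono` and the affine time change
  `s ↦ Q⁻¹ (s + Q t₀)` mapping `[-Q t₀, 0]` onto `[0, t₀]` (`mem_Icc_of_rescaledTime`);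
* `|Rm| ≤ 1`: `curvatureBoundedBy_constSmul_iff` (`|Rm| ↦ Q⁻¹ |Rm|`, Topping 2006, §1.2.3);
  non-flatness: the picked quadruple rescaled by `Q^{-1/2}` (`exists_quadruple_constSmul`);
* NLC: `IsKappaNoncollapsed.parabolicRescale` at the scale `r₀ / √Q < √t₀ ≤ √T`, then invariance
  of the parabolic definition under time translation and under restriction of the time set
  (`isKappaNoncollapsed_comp_add_const`, `isKappaNoncollapsed_of_subset`);
* floor: **scale invariance of `𝒲` and `μ`**, `𝒲(c g, f, c τ) = 𝒲(g, f, τ)` and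
  `μ(c g, c τ) = μ(g, τ)` (`wEntropy_constSmul`, `muEntropy_constSmul`, `muEntropy_constSmul_div`;
  Perelman 2002, §3.1; Topping 2006, Prop. 8.1.2): Perelman's density `(4π c τ)^{-n/2} e^{-f}`
  scales by `(√c)^{-n}` (`entropyDensity_mul`), the measure by `(√c)^n` (`riemVolume_constSmul`),
  `R` and `|∇f|²` by `c⁻¹` (`scalarCurvatureWith_constSmul`, `gradSq_constSmul`); hence
  compatibility and the admissible class are unchanged (`isEntropyCompatible_constSmul_iff`) and
  the infima agree (`le_muEntropy_iff` in both directions). Applied with `c = Q_k` at the original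
  time `t_k + s / Q_k ∈ [0, t_k] ⊆ [0, T)` and the scale `τ / Q_k > 0`; no monotonicity of `μ` is
  used.

## Design

The density lemma assumes `τ ≥ 0` (for `τ < 0` the power `(4πτ)^{-n/2}` is a junk `Real.rpow` of
a negative base and `Real.mul_rpow` is unavailable); all uses have `τ > 0`. The helpers are stated
for a general model with corners `I` on `E`, `n = finrank ℝ E`.

## References

* [Hamilton1995] R. S. Hamilton, *The formation of singularities in the Ricci flow*, Surveys in
  Differential Geometry II, International Press 1995, 7–136, §16.
* [Topping2006] P. Topping, *Lectures on the Ricci flow*, LMS Lecture Note Series 325, Cambridge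
  Univ. Press 2006, §1.2.3 (1.2.7), §7.3, §8.1 (Def. 8.1.1, Prop. 8.1.2).
* [Perelman2002] G. Perelman, *The entropy formula for the Ricci flow and its geometric
  applications*, arXiv:math/0211159 (2002), §3.1 and §4, Def. 4.2.
-/

noncomputable section

open scoped Manifold ContDiff Topology ENNReal NNReal ContinuousMap
open Set MeasureTheory Module
open Literature.Geometry.Lorentzian Literature.Geometry.Riemannian

namespace Summit.SmoothPoincare4.SmoothPoincare4.Theorems.SubcylindricalRecognition.AncientSphereRigidity

variable {E : Type*} [NormedAddCommGroup E] [NormedSpace ℝ E] [FiniteDimensional ℝ E]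
  {H : Type*} [TopologicalSpace H] {I : ModelWithCorners ℝ E H} {M : Type*} [TopologicalSpace M]
  [ChartedSpace H M] [IsManifold I ∞ M]

/-! ### Perelman's density and the Riemannian measure under `(g, τ) ↦ (c g, c τ)` -/

omit [TopologicalSpace M] in
/-- Perelman's density under `τ ↦ c τ`: `(4π c τ)^{-n/2} e^{-f} = ((√c)^n)⁻¹ (4πτ)^{-n/2} e^{-f}`
for `c > 0`, `τ ≥ 0`. [folklore] -/
theorem entropyDensity_mul {c τ : ℝ} (hc : 0 < c) (hτ : 0 ≤ τ) (n : ℕ) (f : M → ℝ) (x : M) :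
    entropyDensity n f (c * τ) x = (Real.sqrt c ^ n)⁻¹ * entropyDensity n f τ x := by
  have h4 : 0 ≤ 4 * Real.pi * τ := by positivity
  rw [entropyDensity_apply, entropyDensity_apply, mul_left_comm (4 * Real.pi) c τ,
    Real.mul_rpow hc.le h4, Real.rpow_div_two_eq_sqrt (-(n : ℝ)) hc.le,
    Real.rpow_neg (Real.sqrt_nonneg c), Real.rpow_natCast, mul_assoc]

variable [T3Space M] [MeasurableSpace M] [BorelSpace M]

/-- **Change of measure under homothety** in Bochner integrals: since `dV_{c g} = (√c)^n dV_g`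
(`riemVolume_constSmul`, `n = dim M`), `∫ ((√c)^n)⁻¹ F dV_{c g} = ∫ F dV_g` for every real
`F` (integrable or not). [cite: Topping2006, §1.2.3] -/
theorem integral_constSmul_mul (g : PseudoRiemannianMetric I ∞ E (TangentSpace I : M → Type _))
    {c : ℝ} (hc : 0 < c) (F : M → ℝ) :
    ∫ x, (Real.sqrt c ^ finrank ℝ E)⁻¹ * F x ∂(g.constSmul c hc.ne').riemVolume =
      ∫ x, F x ∂g.riemVolume := by
  have hne : Real.sqrt c ^ finrank ℝ E ≠ 0 := pow_ne_zero _ (Real.sqrt_pos.2 hc).ne'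
  rw [PseudoRiemannianMetric.riemVolume_constSmul g hc, integral_smul_measure, integral_const_mul,
    ENNReal.toReal_pow, ENNReal.toReal_ofReal (Real.sqrt_nonneg c), smul_eq_mul, ← mul_assoc,
    mul_inv_cancel₀ hne, one_mul]

/-- **Compatibility is scale invariant**: `(c g, f, c τ)` is compatible iff `(g, f, τ)` is
(`c > 0`, `τ ≥ 0`): `∫ (4π c τ)^{-n/2} e^{-f} dV_{c g} = ∫ (4πτ)^{-n/2} e^{-f} dV_g`
(Topping 2006, §8.1, proof of Prop. 8.1.2). [cite: Topping2006, §8.1, Prop. 8.1.2] -/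
theorem isEntropyCompatible_constSmul_iff
    (g : PseudoRiemannianMetric I ∞ E (TangentSpace I : M → Type _)) {c τ : ℝ} (hc : 0 < c)
    (hτ : 0 ≤ τ) (f : M → ℝ) :
    (g.constSmul c hc.ne').IsEntropyCompatible f (c * τ) ↔ g.IsEntropyCompatible f τ := by
  rw [PseudoRiemannianMetric.isEntropyCompatible_iff,
    PseudoRiemannianMetric.isEntropyCompatible_iff]
  simp_rw [entropyDensity_mul hc hτ]
  rw [integral_constSmul_mul g hc]

/-- **Scale invariance of Perelman's `𝒲`-entropy** (Perelman 2002, §3.1: "`𝒲` is invariant under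
simultaneous scaling of `τ` and `g_ij`"; Topping 2006, Prop. 8.1.2 (i)): for `c > 0`, `τ ≥ 0` and
any connection `cov`, `𝒲(c g, f, c τ) = 𝒲(g, f, τ)` — the integrand
`[c τ (R_{c g} + |∇f|²_{c g}) + f - n] u_{f, c τ} = ((√c)^n)⁻¹ [τ (R_g + |∇f|²_g) + f - n] u_{f, τ}`
(`scalarCurvatureWith_constSmul`, `gradSq_constSmul`, `entropyDensity_mul`) against
`dV_{c g} = (√c)^n dV_g`. [cite: Topping2006, §8.1, Prop. 8.1.2] -/
theorem wEntropy_constSmul (g : PseudoRiemannianMetric I ∞ E (TangentSpace I : M → Type _))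
    (cov : CovariantDerivative I E (TangentSpace I : M → Type _)) {c τ : ℝ} (hc : 0 < c)
    (hτ : 0 ≤ τ) (f : M → ℝ) :
    (g.constSmul c hc.ne').wEntropy cov f (c * τ) = g.wEntropy cov f τ := by
  rw [PseudoRiemannianMetric.wEntropy_def, PseudoRiemannianMetric.wEntropy_def]
  have hpt : ∀ x, (c * τ * ((g.constSmul c hc.ne').scalarCurvatureWith cov x +
      (g.constSmul c hc.ne').gradSq f x) + f x - finrank ℝ E) *
        entropyDensity (finrank ℝ E) f (c * τ) x =
      (Real.sqrt c ^ finrank ℝ E)⁻¹ * ((τ * (g.scalarCurvatureWith cov x + g.gradSq f x) +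
        f x - finrank ℝ E) * entropyDensity (finrank ℝ E) f τ x) := by
    intro x
    have hcτ : c * τ * (c⁻¹ * g.scalarCurvatureWith cov x + c⁻¹ * g.gradSq f x) =
        τ * (g.scalarCurvatureWith cov x + g.gradSq f x) := by
      field_simp
    rw [PseudoRiemannianMetric.scalarCurvatureWith_constSmul,
      PseudoRiemannianMetric.gradSq_constSmul, entropyDensity_mul hc hτ, hcτ]
    ring
  simp_rw [hpt]
  exact integral_constSmul_mul g hc _

/-- **Scale invariance of Perelman's `μ`** (Perelman 2002, §3.1; Topping 2006, Prop. 8.1.2 and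
(8.1.6)): `μ(c g, c τ) = μ(g, τ)` for `c > 0`, `τ ≥ 0`, with the same connection — the
admissible classes (smooth compatible `f`) of `(g, τ)` and `(c g, c τ)` coincide
(`isEntropyCompatible_constSmul_iff`) and `𝒲` agrees on them (`wEntropy_constSmul`).
[cite: Topping2006, §8.1, Prop. 8.1.2] -/
theorem muEntropy_constSmul (g : PseudoRiemannianMetric I ∞ E (TangentSpace I : M → Type _))
    (cov : CovariantDerivative I E (TangentSpace I : M → Type _)) {c τ : ℝ} (hc : 0 < c)
    (hτ : 0 ≤ τ) :
    (g.constSmul c hc.ne').muEntropy cov (c * τ) = g.muEntropy cov τ := by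
  apply le_antisymm
  · rw [PseudoRiemannianMetric.le_muEntropy_iff]
    intro f hf hcf
    rw [← wEntropy_constSmul g cov hc hτ f]
    exact PseudoRiemannianMetric.muEntropy_le hf
      ((isEntropyCompatible_constSmul_iff g hc hτ f).2 hcf)
  · rw [PseudoRiemannianMetric.le_muEntropy_iff]
    intro f hf hcf
    rw [wEntropy_constSmul g cov hc hτ f]
    exact PseudoRiemannianMetric.muEntropy_le hf
      ((isEntropyCompatible_constSmul_iff g hc hτ f).1 hcf)

/-- **Scale invariance of `μ`, divided form**: `μ(c g, τ) = μ(g, τ / c)` for `c > 0`, `τ ≥ 0`.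
[cite: Topping2006, §8.1, Prop. 8.1.2] -/
theorem muEntropy_constSmul_div (g : PseudoRiemannianMetric I ∞ E (TangentSpace I : M → Type _))
    (cov : CovariantDerivative I E (TangentSpace I : M → Type _)) {c τ : ℝ} (hc : 0 < c)
    (hτ : 0 ≤ τ) :
    (g.constSmul c hc.ne').muEntropy cov τ = g.muEntropy cov (τ / c) := by
  have h := muEntropy_constSmul g cov hc (div_nonneg hτ hc.le)
  rwa [mul_div_cancel₀ τ hc.ne'] at h

/-! ### `κ`-noncollapsing: restriction of the time set and time translation -/

/-- `κ`-noncollapsing on a time set `S` restricts to every `S' ⊆ S` (fewer parabolic windows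
`[t₀ - r₀², t₀] ⊆ S'` are tested). [folklore] -/
theorem isKappaNoncollapsed_of_subset
    {g : ℝ → PseudoRiemannianMetric I ∞ E (TangentSpace I : M → Type _)}
    {cov : ℝ → CovariantDerivative I E (TangentSpace I : M → Type _)} {S S' : Set ℝ} {κ r₀ : ℝ}
    (h : IsKappaNoncollapsed g cov S κ r₀) (hS : S' ⊆ S) : IsKappaNoncollapsed g cov S' κ r₀ :=
  fun x₀ t₀ hI hcurv ↦ h x₀ t₀ (hI.trans hS) hcurv

/-- **`κ`-noncollapsing is invariant under time translation**: if `(g, cov)` is `κ`-noncollapsed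
for scale `r₀` on `S`, then `s ↦ (g (s + a), cov (s + a))` is `κ`-noncollapsed for scale `r₀` on
`(· + a)⁻¹' S` (the window `[t₀ - r₀², t₀]` of the translate is the window `[t₀ + a - r₀², t₀ + a]`
of the original). [folklore] -/
theorem isKappaNoncollapsed_comp_add_const
    {g : ℝ → PseudoRiemannianMetric I ∞ E (TangentSpace I : M → Type _)}
    {cov : ℝ → CovariantDerivative I E (TangentSpace I : M → Type _)} {S : Set ℝ} {κ r₀ : ℝ}
    (h : IsKappaNoncollapsed g cov S κ r₀) (a : ℝ) :
    IsKappaNoncollapsed (fun s ↦ g (s + a)) (fun s ↦ cov (s + a)) ((· + a) ⁻¹' S) κ r₀ := by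
  intro x₀ t₀ hI hcurv
  have hI' : Icc (t₀ + a - r₀ ^ 2) (t₀ + a) ⊆ S := by
    intro t ht
    have hmem : t - a ∈ Icc (t₀ - r₀ ^ 2) t₀ := ⟨by linarith [ht.1], by linarith [ht.2]⟩
    have := hI hmem
    simpa using this
  have hcurv' : ∀ t ∈ Icc (t₀ + a - r₀ ^ 2) (t₀ + a),
      CurvatureBoundedOn (g t) (cov t) ((g t).ball x₀ (ENNReal.ofReal r₀)) (r₀⁻¹ ^ 2) := by
    intro t ht
    have := hcurv (t - a) ⟨by linarith [ht.1], by linarith [ht.2]⟩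
    simpa using this
  exact h x₀ (t₀ + a) hI' hcurv'

/-! ### Unit-bounded quadruples under homothety -/

omit [FiniteDimensional ℝ E] [T3Space M] [MeasurableSpace M] [BorelSpace M] in
/-- **Rescaling a unit-bounded quadruple** (Topping 2006, §1.2.3: `|Rm| ↦ λ⁻¹ |Rm|` under
`g ↦ λ g`): if `X, Y, Z, W` are `h`-unit-bounded (`h(X,X) ≤ 1`, …), then `c^{-1/2} X, …` are
`c h`-unit-bounded and
`|Rm_{c h}(c^{-1/2}X, …)| = c · c⁻² |Rm_h(X, Y, Z, W)| = c⁻¹ |Rm_h(X, Y, Z, W)|`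
(`curvatureForm_constSmul`, degree-`4` homogeneity of `Rm`). [cite: Topping2006, §1.2.3] -/
theorem exists_quadruple_constSmul {n : ℕ∞ω}
    (h : PseudoRiemannianMetric I n E (TangentSpace I : M → Type _))
    (cov₀ : CovariantDerivative I E (TangentSpace I : M → Type _)) {c : ℝ} (hc : 0 < c) (x : M)
    {X Y Z W : TangentSpace I x} (hX : h.val x X X ≤ 1) (hY : h.val x Y Y ≤ 1)
    (hZ : h.val x Z Z ≤ 1) (hW : h.val x W W ≤ 1) :
    ∃ X' Y' Z' W' : TangentSpace I x,
      (h.constSmul c hc.ne').val x X' X' ≤ 1 ∧ (h.constSmul c hc.ne').val x Y' Y' ≤ 1 ∧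
      (h.constSmul c hc.ne').val x Z' Z' ≤ 1 ∧ (h.constSmul c hc.ne').val x W' W' ≤ 1 ∧
      |(h.constSmul c hc.ne').curvatureForm cov₀ x X' Y' Z' W'| =
        c⁻¹ * |h.curvatureForm cov₀ x X Y Z W| := by
  set a : ℝ := (Real.sqrt c)⁻¹ with ha
  have hsq : Real.sqrt c ^ 2 = c := Real.sq_sqrt hc.le
  have ha2 : c * a ^ 2 = 1 := by rw [ha, inv_pow, hsq, mul_inv_cancel₀ hc.ne']
  have hunit : ∀ V : TangentSpace I x, h.val x V V ≤ 1 →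
      (h.constSmul c hc.ne').val x (a • V) (a • V) ≤ 1 := by
    intro V hV
    have hval : (h.constSmul c hc.ne').val x (a • V) (a • V) = c * a ^ 2 * h.val x V V := by
      simp only [PseudoRiemannianMetric.constSmul_apply, map_smul, smul_apply, smul_eq_mul]
      ring
    rw [hval, ha2, one_mul]
    exact hV
  refine ⟨a • X, a • Y, a • Z, a • W, hunit X hX, hunit Y hY, hunit Z hZ, hunit W hW, ?_⟩
  have h4 : Real.sqrt c ^ 4 = c ^ 2 := by
    rw [show (4 : ℕ) = 2 * 2 from rfl, pow_mul, hsq]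
  rw [PseudoRiemannianMetric.curvatureForm_constSmul,
    Literature.Geometry.Riemannian.curvatureForm_smul_smul_smul_smul, ha, inv_pow, h4, abs_mul,
    abs_mul, abs_of_pos hc, abs_of_pos (inv_pos.2 (pow_pos hc 2)), ← mul_assoc]
  congr 1
  field_simp

/-! ### The affine time change of the blow-up rescaling -/

/-- For `Q > 0` and `s ∈ [-Q t₀, 0]` the original time `Q⁻¹ (s + Q t₀)` lies in `[0, t₀]`.
[folklore] -/
theorem mem_Icc_of_rescaledTime {Q t₀ s : ℝ} (hQ : 0 < Q) (hs : s ∈ Icc (-(Q * t₀)) 0) :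
    Q⁻¹ * (s + Q * t₀) ∈ Icc 0 t₀ := by
  refine ⟨mul_nonneg (inv_pos.2 hQ).le (by linarith [hs.1]), ?_⟩
  have h1 : s + Q * t₀ ≤ Q * t₀ := by linarith [hs.2]
  calc Q⁻¹ * (s + Q * t₀) ≤ Q⁻¹ * (Q * t₀) := mul_le_mul_of_nonneg_left h1 (inv_pos.2 hQ).le
    _ = t₀ := inv_mul_cancel_left₀ hQ.ne' t₀

/-- For `Q > 0` and `t₀ < T`: `[-Q t₀, 0] ⊆ (· + Q t₀)⁻¹' [0, Q T)`, the time set of the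
translate of the rescaled flow on `[0, Q T)`. [folklore] -/
theorem Icc_subset_preimage_Ico {Q t₀ T : ℝ} (hQ : 0 < Q) (ht₀ : t₀ < T) :
    Icc (-(Q * t₀)) 0 ⊆ (· + Q * t₀) ⁻¹' Ico 0 (Q * T) := by
  intro s hs
  refine ⟨by linarith [hs.1], ?_⟩
  have h1 : s + Q * t₀ ≤ Q * t₀ := by linarith [hs.2]
  exact h1.trans_lt (mul_lt_mul_of_pos_left ht₀ hQ)

/-! ### The stub -/

/-- **The rescaled blow-up sequence** (Hamilton 1995, §16; Topping 2006, (1.2.7), §7.3 and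
Prop. 8.1.2). Given a maximal Ricci flow `(g, cov)` of Riemannian metrics on the closed
`4`-manifold `M` over `[0, T)`, `κ`-noncollapsed below the scale `√T`, with the entropy floor
`μ(g(t), τ) ≥ ν_cyl + δ'` for all `t ∈ [0, T)`, `τ > 0`, and point-picking data `(t_k, Q_k, x_k)`
(`t_k ∈ [0, T)`, `Q_k > 0`, `Q_k t_k ≥ k`, `|Rm| ≤ Q_k` on `M × [0, t_k]`, a `g(t_k)`-unit-bounded
quadruple at `x_k` with `|Rm| ≥ Q_k / 2`), the parabolic rescalings
`g_k(s) = Q_k g(t_k + s / Q_k)`, `s ∈ [-Q_k t_k, 0]` (same Levi-Civita connections) are Ricci flows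
of Riemannian metrics (`IsRicciFlow.parabolicRescale`, `.comp_add_const`) with `|Rm| ≤ 1`
(`curvatureBoundedBy_constSmul_iff`), `|Rm_{g_k}|(x_k, 0) ≥ 1/2` on a unit-bounded quadruple
(`exists_quadruple_constSmul`), `κ`-noncollapsed below `√(Q_k t_k)` with the same `κ`
(`IsKappaNoncollapsed.parabolicRescale` and time translation), and with the same entropy floor,
by the scale invariance `μ(Q g, τ) = μ(g, τ / Q)` (`muEntropy_constSmul_div`) applied along the
original flow. [cite: Hamilton1995, §16] [cite: Topping2006, §1.2.3, (1.2.7)] -/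
theorem stub_rescaledSequence :
    ∀ (M : Type) [TopologicalSpace M] [T2Space M] [SecondCountableTopology M]
      [ChartedSpace (EuclideanSpace ℝ (Fin 4)) M] [IsManifold (𝓡 4) ∞ M] [CompactSpace M]
      [ConnectedSpace M] [T3Space M] [MeasurableSpace M] [BorelSpace M] (T δ' κ : ℝ),
      0 < δ' → 0 < κ →
      ∀ (g : ℝ → PseudoRiemannianMetric (𝓡 4) ∞ (EuclideanSpace ℝ (Fin 4)) (TangentSpace (𝓡 4) : M → Type _))
        (cov : ℝ → CovariantDerivative (𝓡 4) (EuclideanSpace ℝ (Fin 4)) (TangentSpace (𝓡 4) : M → Type _)),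
      IsMaximalRicciFlow g cov T →
      (∀ r₀ : ℝ, 0 < r₀ → r₀ < Real.sqrt T → IsKappaNoncollapsed g cov (Set.Ico 0 T) κ r₀) →
      (∀ t ∈ Set.Ico 0 T, ∀ τ : ℝ, 0 < τ →
        ((Real.log 2 + Real.log Real.pi / 2 - 3 / 2 + δ' : ℝ) : EReal) ≤ (g t).muEntropy (cov t) τ) →
      ∀ (tk Qk : ℕ → ℝ) (xk : ℕ → M),
      (∀ k, tk k ∈ Set.Ico 0 T) → (∀ k, 0 < Qk k) → (∀ k : ℕ, (k : ℝ) ≤ Qk k * tk k) →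
      (∀ k, ∀ t ∈ Set.Icc 0 (tk k), CurvatureBoundedBy (g t) (cov t) (Qk k)) →
      (∀ k, ∃ X Y Z W : TangentSpace (𝓡 4) (xk k),
        (g (tk k)).val (xk k) X X ≤ 1 ∧ (g (tk k)).val (xk k) Y Y ≤ 1 ∧
        (g (tk k)).val (xk k) Z Z ≤ 1 ∧ (g (tk k)).val (xk k) W W ≤ 1 ∧
        Qk k / 2 ≤ |(g (tk k)).curvatureForm (cov (tk k)) (xk k) X Y Z W|) →
      ∃ (κ' δ'' c : ℝ), 0 < κ' ∧ 0 < δ'' ∧ 0 < c ∧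
        ∃ (A : ℕ → ℝ)
          (gk : ℕ → ℝ → PseudoRiemannianMetric (𝓡 4) ∞ (EuclideanSpace ℝ (Fin 4)) (TangentSpace (𝓡 4) : M → Type _))
          (covk : ℕ → ℝ → CovariantDerivative (𝓡 4) (EuclideanSpace ℝ (Fin 4)) (TangentSpace (𝓡 4) : M → Type _))
          (xk' : ℕ → M),
          (∀ k : ℕ, (k : ℝ) ≤ A k) ∧
          (∀ k, IsRicciFlow (gk k) (covk k) (Set.Icc (-(A k)) 0)) ∧
          (∀ k, ∀ t ∈ Set.Icc (-(A k)) 0, (gk k t).IsRiemannian) ∧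
          (∀ k, ∀ t ∈ Set.Icc (-(A k)) 0, CurvatureBoundedBy (gk k t) (covk k t) 1) ∧
          (∀ k, ∃ X Y Z W : TangentSpace (𝓡 4) (xk' k),
            (gk k 0).val (xk' k) X X ≤ 1 ∧ (gk k 0).val (xk' k) Y Y ≤ 1 ∧
            (gk k 0).val (xk' k) Z Z ≤ 1 ∧ (gk k 0).val (xk' k) W W ≤ 1 ∧
            c ≤ |(gk k 0).curvatureForm (covk k 0) (xk' k) X Y Z W|) ∧
          (∀ k, ∀ r₀ : ℝ, 0 < r₀ → r₀ < Real.sqrt (A k) →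
            IsKappaNoncollapsed (gk k) (covk k) (Set.Icc (-(A k)) 0) κ' r₀) ∧
          (∀ k, ∀ t ∈ Set.Icc (-(A k)) 0, ∀ τ : ℝ, 0 < τ →
            ((Real.log 2 + Real.log Real.pi / 2 - 3 / 2 + δ'' : ℝ) : EReal) ≤
              (gk k t).muEntropy (covk k t) τ) := by
  intro M _ _ _ _ _ _ _ _ _ _ T δ' κ hδ' hκ g cov hmax hnc hfloor tk Qk xk htk hQk hA hbd hpick
  refine ⟨κ, δ', 1 / 2, hκ, hδ', by norm_num, fun k ↦ Qk k * tk k,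
    fun k s ↦ (g ((Qk k)⁻¹ * (s + Qk k * tk k))).constSmul (Qk k) (hQk k).ne',
    fun k s ↦ cov ((Qk k)⁻¹ * (s + Qk k * tk k)), xk, hA, ?_, ?_, ?_, ?_, ?_, ?_⟩
  · -- (ii) `g_k` is a Ricci flow on `[-Q_k t_k, 0]`: rescale by `Q_k`, translate by `Q_k t_k`
    intro k
    refine ((hmax.isRicciFlow.parabolicRescale (hQk k)).comp_add_const (Qk k * tk k)).mono ?_
    intro s hs
    have ht := mem_Icc_of_rescaledTime (hQk k) hs
    exact ⟨ht.1, ht.2.trans_lt (htk k).2⟩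
  · -- (iii) the metrics are Riemannian
    intro k s hs
    have ht := mem_Icc_of_rescaledTime (hQk k) hs
    exact (hmax.isRiemannian _ ⟨ht.1, ht.2.trans_lt (htk k).2⟩).constSmul (hQk k)
  · -- (iv) `|Rm_{g_k}| ≤ 1` from `|Rm_g| ≤ Q_k` on `M × [0, t_k]`
    intro k s hs
    have ht := mem_Icc_of_rescaledTime (hQk k) hs
    refine (curvatureBoundedBy_constSmul_iff _ _ (hQk k) 1).2 ?_
    rw [mul_one]
    exact hbd k _ ht
  · -- (v) non-flatness at `(x_k, 0)`: `|Rm_{Q g}| = Q⁻¹ |Rm_g| ≥ Q⁻¹ (Q / 2) = 1 / 2`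
    intro k
    obtain ⟨X, Y, Z, W, hX, hY, hZ, hW, hRm⟩ := hpick k
    have ht : tk k = (Qk k)⁻¹ * (0 + Qk k * tk k) := by
      rw [zero_add, inv_mul_cancel_left₀ (hQk k).ne']
    have key : ∀ t : ℝ, tk k = t → ∃ X' Y' Z' W' : TangentSpace (𝓡 4) (xk k),
        ((g t).constSmul (Qk k) (hQk k).ne').val (xk k) X' X' ≤ 1 ∧
        ((g t).constSmul (Qk k) (hQk k).ne').val (xk k) Y' Y' ≤ 1 ∧
        ((g t).constSmul (Qk k) (hQk k).ne').val (xk k) Z' Z' ≤ 1 ∧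
        ((g t).constSmul (Qk k) (hQk k).ne').val (xk k) W' W' ≤ 1 ∧
        1 / 2 ≤
          |((g t).constSmul (Qk k) (hQk k).ne').curvatureForm (cov t) (xk k) X' Y' Z' W'| := by
      rintro t rfl
      obtain ⟨X', Y', Z', W', hX', hY', hZ', hW', hRm'⟩ :=
        exists_quadruple_constSmul (g (tk k)) (cov (tk k)) (hQk k) (xk k) hX hY hZ hW
      refine ⟨X', Y', Z', W', hX', hY', hZ', hW', ?_⟩
      rw [hRm', le_inv_mul_iff₀ (hQk k)]
      linarith
    exact key _ ht
  · -- (vi) `κ`-noncollapsing below `√(Q_k t_k)`: rescale the hypothesis at scale `r₀ / √Q_k < √T`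
    intro k r₀ hr₀ hr₀A
    have hQ := hQk k
    have hsQ : 0 < Real.sqrt (Qk k) := Real.sqrt_pos.2 hQ
    have hr₀A' : r₀ < Real.sqrt (Qk k * tk k) := hr₀A
    set r : ℝ := r₀ / Real.sqrt (Qk k) with hr_def
    have hr : 0 < r := div_pos hr₀ hsQ
    have hrr₀ : Real.sqrt (Qk k) * r = r₀ := mul_div_cancel₀ r₀ hsQ.ne'
    have hrT : r < Real.sqrt T := by
      have h1 : r₀ < Real.sqrt (tk k) * Real.sqrt (Qk k) := by
        rwa [mul_comm, ← Real.sqrt_mul hQ.le]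
      exact ((div_lt_iff₀ hsQ).2 h1).trans_le (Real.sqrt_le_sqrt (htk k).2.le)
    have hpar := (hnc r hr hrT).parabolicRescale hQ hr.le
    rw [hrr₀] at hpar
    exact isKappaNoncollapsed_of_subset (isKappaNoncollapsed_comp_add_const hpar (Qk k * tk k))
      (Icc_subset_preimage_Ico hQ (htk k).2)
  · -- (vii) the entropy floor, by scale invariance of `μ` along the original flow
    intro k s hs τ hτ
    have hQ := hQk k
    have ht := mem_Icc_of_rescaledTime hQ hs
    have key := hfloor _ ⟨ht.1, ht.2.trans_lt (htk k).2⟩ (τ / Qk k) (div_pos hτ hQ)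
    rw [← muEntropy_constSmul_div _ _ hQ hτ.le] at key
    exact key

end Summit.SmoothPoincare4.SmoothPoincare4.Theorems.SubcylindricalRecognition.AncientSphereRigidity

end
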